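import Literature.AlgebraicGeometry.HodgeTheory.FermatAokiSubvarietyCycle
import Literature.AlgebraicGeometry.HodgeTheory.FermatAokiSubvarietyDimension
import Literature.AlgebraicGeometry.HodgeTheory.FermatAokiSubvarietyStabilizer
import Literature.AlgebraicGeometry.HodgeTheory.FermatClaimPermutationInvariance
import Literature.AlgebraicGeometry.HodgeTheory.ComplexGysinIsomorphisms
import Literature.AlgebraicGeometry.HodgeTheory.ComplexOrientationDegreeFormulaHolds
import Literature.AlgebraicGeometry.HodgeTheory.CycleClassPushforward
import Literature.AlgebraicGeometry.Motives.SubschemeCyclesFundamentalProofs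
import HarnessLib

/-!
# The cycle `[Y]` of Aoki's subvariety is non-zero, and it and its class are invariant under the symmetries of `Y` (Aoki §4 (4.1))

Family `hodge`, layer `Literature/AlgebraicGeometry/HodgeTheory`. PROOF FILE (theorems only, no
definition, no named fact; sequel of `FermatAokiSubvarietyCycle`, `FermatAokiSubvarietyDimension`,
`FermatAokiSubvarietyStabilizer`) for the leaf `Aoki1987_thm_2_1_supportedClass` of the named fact
`Aoki1987_claim_pStandard` — N. Aoki, *Some new algebraic cycles on Fermat varieties*, J. Math. Soc.
Japan 39 (1987), Thm. 2-1 (p. 388), Prop. 3-1 (ii) (p. 389: `G_Y = G₀ ∩ Ker σ`), §4 (4.1) (the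
class of `Y` is fixed by its stabiliser, so that `ω_α(Y)·\overline{ω_α(Y)}` is an orbit sum over
`G/G_Y` of intersection numbers `I(Y, Yᵍ)`).

* `Aoki1987.fermatAokiCycle_ne_zero`, `…_of_dvd`, `Aoki1987.exists_fermatAokiCycle_ne_zero` — **the
  `r`-cycle `[Y]` of `Y ∩ X²ʳₘ` is not zero** (`m = pd`, `cᵈ = -p`): `Y ∩ X` has an `r`-dimensional
  point (`Aoki1987.exists_mem_fermatAokiSection_height_eq`). So the hypothesis of
  `Aoki1987_thm_2_1_supportedClass_of_projector_cycleClass_ne_zero` is about a genuine cycle.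
* `Aoki1987.cyclesOfDimMap_fermatAokiCycle_eq` — an automorphism `t` of the scheme `X²ʳₘ` with
  `t⁻¹(Y) = Y` fixes the cycle: `t_*[Y] = [Y]` (it permutes the `r`-dimensional points of `Y`;
  `t_*[closure {z}] = [closure {t z}]`, `Motives.algebraicCycleMap_primeCycle`).
* `Aoki1987.map_cycleClass_fermatAokiCycle_eq` — **`t^* cl[Y] = cl[Y]`** for mutually inverse
  automorphisms `t, s` over `ℂ` with `s⁻¹(Y) = Y`, for the complex-orientation cycle class of the
  tree: `t^* = s_*` (`complexBetti_map_eq_complexGysin_of_comp_eq_id`, Fulton *Young Tableaux* App. B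
  (5)–(6)), `s_* cl[Y] = cl[s_*[Y]]` (Voisin II Prop. 9.21 (ii), `cycleClass_cyclesOfDimMap`, with
  Fulton's degree formula `Fulton1998_degreeFormula_complexOrientation_holds`), `s_*[Y] = [Y]`.
* `Aoki1987.map_diagonalAut_cycleClass_fermatAokiCycle_eq` — **`g_a^* cl[Y] = cl[Y]` for the
  diagonal symmetries `a ∈ G₀ ∩ Ker(1, …, 1, -p)`** (`a₀ᵈ = ⋯ = a_{p-1}ᵈ`, `a_pᵖ = a₀⋯a_{p-1}`;
  Prop. 3-1 (ii) `G₀ ∩ Ker σ ⊆ G_Y`, `preimage_fermatAokiSection_diagonalAut`).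

## References

* [Aoki1987] N. Aoki, Some new algebraic cycles on Fermat varieties, J. Math. Soc. Japan 39 (1987)
  385–396: Thm. 2-1 (p. 388), Prop. 3-1 (ii) (p. 389) and its proof (p. 390), §4 (4.1).
* [VoisinHodgeII2003] C. Voisin, Hodge Theory and Complex Algebraic Geometry II, CUP 2003,
  Prop. 9.21 (ii).
* [FultonYoungTableaux1997] W. Fulton, Young Tableaux, CUP 1997, Appendix B §B.1 (5), (6).
* [Fulton1998] W. Fulton, Intersection Theory, 2nd ed. 1998, §1.4, Lemma 19.1.2.
-/

noncomputable section

open CategoryTheory AlgebraicGeometry MvPolynomial Finset Order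

namespace Literature.AlgebraicGeometry.HodgeTheory

open Literature.AlgebraicGeometry.Motives Literature.AlgebraicTopology.SingularHomology

/-! ### An isomorphism is birational -/

/-- An isomorphism of schemes is birational (take `U = ⊤`). [folklore] -/
theorem isBirational_of_isIso' {X Y : Scheme} (e : X ⟶ Y) [IsIso e] : Resolution.IsBirational e :=
  ⟨⊤, by simp, by simp, inferInstance⟩

namespace Aoki1987

variable {m r d : ℕ}

/-! ### `[Y] ≠ 0` -/

/-- **The `r`-cycle `[Y]` of Aoki's `Y ∩ X^{p-1}ₘ` is non-zero** (`m = pd`, `cᵈ = -p`, `r, d ≥ 1`):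
`Y ∩ X` has an `r`-dimensional point (`exists_mem_fermatAokiSection_height_eq`), whose prime cycle is
a summand of `[Y]`. [cite: Aoki1987, Thm. 2-1 (p. 388) and Prop. 3-1 (p. 389)] -/
theorem fermatAokiCycle_ne_zero (hr : 0 < r) (hm1 : 1 ≤ m) (hd : 0 < d) (hm : m = (2 * r + 1) * d)
    {c : ℂ} (hc : c ^ d = -((2 * r + 1 : ℕ) : ℂ)) : fermatAokiCycle hr hm1 hd c ≠ 0 := by
  obtain ⟨z, hzY, hzh, -⟩ := exists_mem_fermatAokiSection_height_eq hr hd hm hc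
  exact fermatAokiCycle_ne_zero_of_mem hr hm1 hd c ⟨hzY, hzh⟩

/-- **`[Y] ≠ 0` in the parameters of the leaf `Aoki1987_thm_2_1_supportedClass`**: `p = 2r + 1 ∣ m`,
`d = m/p ≥ 1`, `c^{m/p} = -p`. [cite: Aoki1987, Thm. 2-1 (p. 388)] -/
theorem fermatAokiCycle_ne_zero_of_dvd (hr : 0 < r) (hm1 : 1 ≤ m) (hpm : 2 * r + 1 ∣ m)
    (hd : 0 < m / (2 * r + 1)) {c : ℂ} (hc : c ^ (m / (2 * r + 1)) = -((2 * r + 1 : ℕ) : ℂ)) :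
    fermatAokiCycle hr hm1 hd c ≠ 0 :=
  fermatAokiCycle_ne_zero hr hm1 hd (Nat.mul_div_cancel' hpm).symm hc

/-- **There is a constant `c₀` with `c₀^{m/p} = -p`, and for every such constant `[Y_{c₀} ∩ X²ʳₘ] ≠ 0`**
(`exists_pow_eq_neg_natCast`; in print `c₀ = εᵖ ᵈ√p`): the hypothesis of
`Aoki1987_thm_2_1_supportedClass_of_projector_cycleClass_ne_zero` concerns a non-zero cycle.
[cite: Aoki1987, (2.1) and Thm. 2-1 (p. 388)] -/
theorem exists_fermatAokiCycle_ne_zero (hr : 0 < r) (hm1 : 1 ≤ m) (hpm : 2 * r + 1 ∣ m)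
    (hd : 0 < m / (2 * r + 1)) :
    ∃ c₀ : ℂ, c₀ ^ (m / (2 * r + 1)) = -((2 * r + 1 : ℕ) : ℂ) ∧ fermatAokiCycle hr hm1 hd c₀ ≠ 0 := by
  obtain ⟨c₀, hc₀⟩ := exists_pow_eq_neg_natCast (2 * r + 1) (m / (2 * r + 1)) hd
  exact ⟨c₀, hc₀, fermatAokiCycle_ne_zero_of_dvd hr hm1 hpm hd hc₀⟩

/-! ### Automorphisms of `X²ʳₘ` preserving `Y` fix the cycle `[Y]` -/

/-- **An automorphism `t` of `X²ʳₘ` with `t⁻¹(Y) = Y` fixes the `r`-cycle `[Y]`**: `t_*[Y] = [Y]`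
(`t` permutes the `r`-dimensional points of `Y`, and `t_*[closure {z}] = [closure {t z}]` for a
closed immersion). [cite: Aoki1987, §4 (4.1)] [cite: Fulton1998, §1.4] -/
theorem cyclesOfDimMap_fermatAokiCycle_eq (hr : 0 < r) (hm : 1 ≤ m) (hd : 0 < d) (c : ℂ)
    (t : (fermatHypersurface (2 * r) m).left ⟶ (fermatHypersurface (2 * r) m).left) [IsIso t]
    (ht : t.base ⁻¹' fermatAokiSection m r d c = fermatAokiSection m r d c) :
    Motives.cyclesOfDimMap r t (fermatAokiCycle hr hm hd c) = fermatAokiCycle hr hm hd c := by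
  classical
  set T := (finite_fermatAokiTop hr hm hd c).toFinset with hT
  -- `t` maps `T` into itself, injectively, hence onto itself
  have hmemT : ∀ z, z ∈ T ↔ z ∈ fermatAokiTop m r d c := fun z ↦ (finite_fermatAokiTop hr hm hd c).mem_toFinset
  have htT : ∀ z ∈ T, t.base z ∈ T := by
    intro z hz
    rw [hmemT] at hz ⊢
    refine ⟨?_, ?_⟩
    · have h1 : z ∈ t.base ⁻¹' fermatAokiSection m r d c := by rw [ht]; exact hz.1
      exact h1
    · rw [Motives.height_base_eq_of_isClosedImmersion' t z]; exact hz.2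
  have hinj : Set.InjOn t.base T := fun a _ b _ hab ↦
    (ConcreteCategory.injective_of_mono_of_preservesPullback t.base) hab
  have himage : T.image t.base = T := by
    refine Finset.eq_of_subset_of_card_le (Finset.image_subset_iff.mpr htT) ?_
    rw [Finset.card_image_of_injOn hinj]
  -- `[Y]` as a sum in `Z_r(X)`
  have hsum : fermatAokiCycle hr hm hd c = ∑ z ∈ T.attach,
      (⟨Motives.primeCycle (z : ↥(fermatHypersurface (2 * r) m).left),
        Motives.primeCycle_mem_cyclesOfDim ((hmemT z).mp z.2).2⟩ :
        ↥(Motives.cyclesOfDim (fermatHypersurface (2 * r) m).left r)) := by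
    apply Subtype.ext
    rw [AddSubgroup.val_finsetSum]
    exact (Finset.sum_attach T fun z ↦ Motives.primeCycle z).symm
  have hmap : ∀ z : T, Motives.cyclesOfDimMap r t
      (⟨Motives.primeCycle (z : ↥(fermatHypersurface (2 * r) m).left),
        Motives.primeCycle_mem_cyclesOfDim ((hmemT z).mp z.2).2⟩ :
        ↥(Motives.cyclesOfDim (fermatHypersurface (2 * r) m).left r)) =
      ⟨Motives.primeCycle (t.base z), Motives.primeCycle_mem_cyclesOfDim
        ((hmemT _).mp (htT z z.2)).2⟩ := by
    intro z
    apply Subtype.ext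
    rw [Motives.coe_cyclesOfDimMap]
    exact Motives.algebraicCycleMap_primeCycle t z
  rw [hsum, map_sum]
  simp_rw [hmap]
  apply Subtype.ext
  rw [AddSubgroup.val_finsetSum, AddSubgroup.val_finsetSum]
  change ∑ z ∈ T.attach, Motives.primeCycle (t.base (z : ↥(fermatHypersurface (2 * r) m).left)) =
    ∑ z ∈ T.attach, Motives.primeCycle (z : ↥(fermatHypersurface (2 * r) m).left)
  rw [Finset.sum_attach T fun z ↦ Motives.primeCycle (t.base z),
    Finset.sum_attach T fun z ↦ Motives.primeCycle z, ← Finset.sum_image fun a ha b hb hab ↦ hinj ha hb hab,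
    himage]

/-- **Automorphisms of `X²ʳₘ` preserving `Y` fix the class `cl [Y]`**: for mutually inverse
`t, s : X²ʳₘ ⟶ X²ʳₘ` over `ℂ` with `s⁻¹(Y) = Y`, `t^* cl[Y] = cl[Y]` for the complex-orientation cycle
class (`t^* = s_*`, `ComplexGysinIsomorphisms`; `s_* cl[Y] = cl[s_*[Y]]`, Voisin II Prop. 9.21 (ii)
`cycleClass_cyclesOfDimMap` with Fulton's degree formula; `s_*[Y] = [Y]`). This is "`h^*[Y] = [Y]` for
`h ∈ G_Y`" of Aoki's §4. [cite: Aoki1987, §4 (4.1)] [cite: VoisinHodgeII2003, Prop. 9.21 (ii)]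
[cite: FultonYoungTableaux1997, Appendix B §B.1 (5)] -/
theorem map_cycleClass_fermatAokiCycle_eq (hr : 0 < r) (hm : 1 ≤ m) (hd : 0 < d) (c : ℂ)
    (hX : IsSmoothProjective (2 * r) (fermatHypersurface (2 * r) m)) (hrr : r + r = 2 * r)
    (ρ : ResolutionFamily (fermatHypersurface (2 * r) m) r)
    {t s : fermatHypersurface (2 * r) m ⟶ fermatHypersurface (2 * r) m}
    (hst : s ≫ t = 𝟙 _) [IsIso s.left]
    (hs : s.left.base ⁻¹' fermatAokiSection m r d c = fermatAokiSection m r d c) :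
    complexBetti.map t (2 * r) (cycleClass complexOrientationFamily hX hrr ρ (fermatAokiCycle hr hm hd c)) =
      cycleClass complexOrientationFamily hX hrr ρ (fermatAokiCycle hr hm hd c) := by
  rw [complexBetti_map_eq_complexGysin_of_comp_eq_id hX hX s t hst (isBirational_of_isIso' s.left)]
  have key := cycleClass_cyclesOfDimMap Fulton1998_degreeFormula_complexOrientation_holds hX hX s hrr hrr ρ ρ
    (fermatAokiCycle hr hm hd c)
  rw [cyclesOfDimMap_fermatAokiCycle_eq hr hm hd c s.left hs] at key
  exact key.symm

/-! ### The diagonal symmetries `G₀ ∩ Ker(1, …, 1, -p)` -/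

/-- **`g_a^* cl[Y] = cl[Y]` for `a ∈ μₘ²ʳ⁺² ∩ G₀ ∩ Ker(1, …, 1, -p)`** (`a₀ᵈ = ⋯ = a_{p-1}ᵈ`,
`a_pᵖ = a₀⋯a_{p-1}`; PROP. 3-1 (ii): `G₀ ∩ Ker σ ⊆ G_Y`, `preimage_fermatAokiSection_diagonalAut`).
[cite: Aoki1987, Prop. 3-1 (ii) (p. 389) and §4 (4.1)] -/
theorem map_diagonalAut_cycleClass_fermatAokiCycle_eq (hr : 0 < r) (hm : 1 ≤ m) (hd : 0 < d) (c : ℂ)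
    (hX : IsSmoothProjective (2 * r) (fermatHypersurface (2 * r) m)) (hrr : r + r = 2 * r)
    (ρ : ResolutionFamily (fermatHypersurface (2 * r) m) r)
    {a : Fin (2 * r + 2) → ℂˣ} (ha : a ∈ diagonalStabilizer (fermatPolynomial ℂ (2 * r) m)) {β : ℂ}
    (hβ : ∀ i : Fin (2 * r + 1), ((a (Fin.castSucc i)) : ℂ) ^ d = β)
    (hρ : a (Fin.last (2 * r + 1)) ^ (2 * r + 1) = ∏ i : Fin (2 * r + 1), a (Fin.castSucc i)) :
    complexBetti.map (diagonalAut (fermatPolynomial ℂ (2 * r) m) ha) (2 * r)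
        (cycleClass complexOrientationFamily hX hrr ρ (fermatAokiCycle hr hm hd c)) =
      cycleClass complexOrientationFamily hX hrr ρ (fermatAokiCycle hr hm hd c) := by
  have hinv : a⁻¹ ∈ diagonalStabilizer (fermatPolynomial ℂ (2 * r) m) := inv_mem ha
  refine map_cycleClass_fermatAokiCycle_eq hr hm hd c hX hrr ρ (s := diagonalAut _ hinv) ?_ ?_
  · exact Over.OverMorphism.ext (by
      rw [Over.comp_left]; exact diagonalAut_left_inv_comp (fermatPolynomial ℂ (2 * r) m) ha)
  · refine preimage_fermatAokiSection_diagonalAut r d hinv (β := β⁻¹) (fun i ↦ ?_) ?_ c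
    · rw [Pi.inv_apply, Units.val_inv_eq_inv_val, inv_pow, hβ i]
    · simp only [Pi.inv_apply, inv_pow, hρ, Finset.prod_inv_distrib]

end Aoki1987

end Literature.AlgebraicGeometry.HodgeTheory

end
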